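import Summits.AtomisticToContinuum.BoseEinsteinCondensation.Theorems.BECProbeMassFlowRecoilTransferZeroMomentumDescent
import Summits.AtomisticToContinuum.BoseEinsteinCondensation.Theorems.BECProbeMassFlowRecoilTransferZeroMomentumAttain
import Literature.MathematicalPhysics.QuantumManyBody.PeriodicBoseGasUpperBoundProofs
import HarnessLib

/-!
# Energy inputs for the fixed-`N` certificate of crux `BECProbeMassFlow.CloudMomentumAtom` over the
# WHOLE admissible class (item stmt-AtomisticToContinuum-12310, line `registered`, lead c5)

The fixed-`N` certificates of lead c4 (`…Theorems.BECProbeMassFlowCloudMomentumAtomFixedN`, `…FixedNCrux`: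
the registered stub `stub_fidelityForEach` and the crux body hold with `∀ N, ∃ ρ₀(N)` in place of
`∃ ρ₀, ∀ ρ < ρ₀, ∀ᶠ N`) are proved for INTEGRABLE `v` only: their two energy inputs are the Born bound
`E_imp ≤ E^per + N L⁻³ ∫v` (p155422) and the constant-state bound `2E^per ≤ N² L⁻³ ∫v`, both vacuous for a
hard core. This file supplies replacements valid for EVERY repulsive finite-range `v` (hard cores, hard
shells, fat-Cantor `⊤`-sets, non-integrable walls included):

* `impurityPeriodicGroundStateEnergy_zero_le_tagged`, `impurityPeriodicGroundStateEnergy_zero_le_succ` —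
  **pinning one of `N + 1` bosons lowers the energy**: `E_imp(N, L, 0) ≤ E^tag_κ(N, L) ≤ E^per(N+1, L)` for
  every mass ratio `κ` (the static scatterer is the `M = ∞` end of the route's mass dial). Proof: the tagged
  infimum is approached inside the sector of zero total momentum (`stub_zeroMomentumAttain`, p-landed for
  crux `RecoilTransfer`), a zero-momentum tagged state IS a lifted pinned state of no larger energy
  (`stub_zeroMomentumDescent`), and a Bose `(N+1)`-state is a tagged state (`taggedPeriodicGroundStateEnergy_one_le`).
  Corollaries: `E^per(N, L) ≤ E^per(N+1, L)` (`periodicGroundStateEnergy_le_succ`) and finiteness of the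
  pinned infimum from finiteness of the free `(N+1)`-gas.
* `exists_pairProfile_of_finiteRange` — for every admissible `v` a `C¹` pair profile (smooth step in `|x|²`
  across the annulus `R₁ ≤ |x| ≤ 2R₁`, `R₁ = max R₀ 1`) VANISHING on the core `|x| ≤ R₀`, so that its pair
  energy `E₁ = ∫(2|∇φ|² + vφ²) = 2∫|∇φ|²` and its integrals `I`, `K` are finite whatever `v` does on `[0, R₀]`.
* `exists_periodicGroundStateEnergy_le_div_sq` — hence, by the landed Jastrow bound
  `LSSY2005_jastrowBound_holds` [LSSY2005, Thm. 2.2, (2.19)–(2.31)], at FIXED particle number `M` the free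
  periodic energy is `O_M(L⁻³)`: for every `c > 0`, `E^per(M, L) ≤ c/L²` on every sufficiently large torus.

With these, `…Theorems.BECProbeMassFlowCloudMomentumAtomFixedNAll` repeats c4's fixed-`N` argument for all
admissible `v`.
-/

noncomputable section

namespace Summit.AtomisticToContinuum.BoseEinsteinCondensation.Cruxes.CloudMomentumAtom.Birth

open MeasureTheory Filter Metric Set Function
open scoped ENNReal NNReal BigOperators
open Literature.MathematicalPhysics.QuantumManyBody.BoseGas
open Summit.AtomisticToContinuum.BoseEinsteinCondensation.Theorems (stub_zeroMomentumAttain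
  stub_zeroMomentumDescent)

variable {N : ℕ} {L : ℝ}

/-! ### Pinning one boson lowers the energy -/

/-- **`E_imp(N, L, 0) ≤ E^tag_κ(N, L)` for every mass ratio `κ`.** The pinned-scatterer infimum of `N`
bosons is below the infimum of the mass-deformed tagged Hamiltonian `H_κ = -κΔ₀ - ∑ⱼΔⱼ + ∑ⱼ v^per(xⱼ - x₀)
+ ∑_{i<j} v^per(xᵢ - xⱼ)` (one tagged particle plus `N` bath bosons on the same torus): the tagged infimum
is approached by states of zero total momentum (`stub_zeroMomentumAttain`), and such a state is
`L^{-3/2} Φ(Y - x₀𝟙)` for an admissible pinned trial state `Φ` with `⟨Φ, H_imp Φ⟩ ≤ ⟨Ψ, H_κ Ψ⟩`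
(`stub_zeroMomentumDescent`). Every measurable `v ≥ 0`, every `N`, `L`, `κ`. [folklore] -/
theorem impurityPeriodicGroundStateEnergy_zero_le_tagged {v : ℝ → ℝ≥0∞} (hv : Measurable v)
    (κ : ℝ) (N : ℕ) (L : ℝ) :
    impurityPeriodicGroundStateEnergy v N L 0 ≤ taggedPeriodicGroundStateEnergy v κ N L := by
  rcases le_or_gt L 0 with hL | hL
  · rw [taggedPeriodicGroundStateEnergy_of_nonpos v κ N hL]
    exact le_top
  refine ENNReal.le_of_forall_pos_le_add fun δ hδ _ => ?_
  obtain ⟨Ψ₀, hQ, hΨ₀⟩ := stub_zeroMomentumAttain v hv N L hL κ δ (ENNReal.coe_pos.2 hδ)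
  obtain ⟨Φ, hΦ, -⟩ := stub_zeroMomentumDescent v hv N L κ Ψ₀ hQ
  exact (impurityPeriodicGroundStateEnergy_le v 0 Φ).trans (hΦ.trans hΨ₀)

/-- **Pinning one of `N + 1` bosons lowers the energy: `E_imp(N, L, 0) ≤ E^per(N + 1, L)`** (the static
scatterer is an infinitely heavy boson: dropping its kinetic term and freezing it can only lower the
infimum). Every measurable `v ≥ 0`, every `N`, `L`. [folklore] -/
theorem impurityPeriodicGroundStateEnergy_zero_le_succ {v : ℝ → ℝ≥0∞} (hv : Measurable v) (N : ℕ)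
    (L : ℝ) : impurityPeriodicGroundStateEnergy v N L 0 ≤ periodicGroundStateEnergy v (N + 1) L :=
  (impurityPeriodicGroundStateEnergy_zero_le_tagged hv 1 N L).trans
    (taggedPeriodicGroundStateEnergy_one_le v N L)

/-- **The periodic ground-state energy is monotone in the particle number**, `E^per(N, L) ≤ E^per(N+1, L)`
(through the pinned problem: `E^per(N) ≤ E_imp(N) ≤ E^per(N+1)`). Every measurable `v ≥ 0`. [folklore] -/
theorem periodicGroundStateEnergy_le_succ {v : ℝ → ℝ≥0∞} (hv : Measurable v) (N : ℕ) (L : ℝ) :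
    periodicGroundStateEnergy v N L ≤ periodicGroundStateEnergy v (N + 1) L :=
  (periodicGroundStateEnergy_le_impurityPeriodicGroundStateEnergy v N L 0).trans
    (impurityPeriodicGroundStateEnergy_zero_le_succ hv N L)

/-- Finiteness of the pinned infimum from finiteness of the free `(N+1)`-boson infimum (hard cores
included). [folklore] -/
theorem impurityPeriodicGroundStateEnergy_zero_ne_top_of_succ {v : ℝ → ℝ≥0∞} (hv : Measurable v)
    {N : ℕ} {L : ℝ} (h : periodicGroundStateEnergy v (N + 1) L ≠ ⊤) :
    impurityPeriodicGroundStateEnergy v N L 0 ≠ ⊤ :=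
  ne_top_of_le_ne_top h (impurityPeriodicGroundStateEnergy_zero_le_succ hv N L)

/-! ### A pair profile vanishing on the core -/

/-- A non-negative function on `ℝ³` bounded by a finite constant and vanishing outside a ball has finite
lower Lebesgue integral. [folklore] -/
theorem lintegral_ne_top_of_le_of_eq_zero {f : Space → ℝ≥0∞} {C : ℝ≥0∞} (hC : C ≠ ⊤) (R : ℝ)
    (h1 : ∀ x, f x ≤ C) (h2 : ∀ x, R < ‖x‖ → f x = 0) : ∫⁻ x, f x ≠ ⊤ := by
  have hle : ∀ x, f x ≤ (closedBall (0 : Space) R).indicator (fun _ => C) x := by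
    intro x
    by_cases hx : x ∈ closedBall (0 : Space) R
    · rw [indicator_of_mem hx]; exact h1 x
    · rw [indicator_of_notMem hx, h2 x (by rwa [mem_closedBall_zero_iff, not_le] at hx)]
  refine ne_top_of_le_ne_top ?_ (lintegral_mono hle)
  rw [lintegral_indicator_const measurableSet_closedBall]
  exact ENNReal.mul_ne_top hC (measure_closedBall_lt_top).ne

/-- **A pair profile vanishing on the core of an admissible potential.** For every repulsive finite-range
`v` (range `R₀`) there are a cut-off `b > 0` and a pair profile `φ` (`C¹`, even, `0 ≤ φ ≤ 1`, `φ = 1` off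
`B_b`) with FINITE pair energy `E₁ = ∫(2|∇φ|² + v(|x|)φ²)`, volume defect `I = ∫(1 - φ²)` and
`K = ∫ φ|∇φ|`: the smooth step `φ(x) = S((|x|² - R₁²)/(3R₁²))` (`S` = `Real.smoothTransition`,
`R₁ = max R₀ 1`, `b = 2R₁`) vanishes where `|x| ≤ R₁`, so `vφ² ≡ 0` whatever `v` does on its core, and
`∇φ` is continuous with compact support. [cite: LSSY2005, Thm. 2.2, proof, (2.17)–(2.18)] -/
theorem exists_pairProfile_of_finiteRange {v : ℝ → ℝ≥0∞} (hv : IsRepulsiveFiniteRange v) :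
    ∃ b : ℝ, 0 < b ∧ ∃ φ : Space → ℝ, IsPairProfile b φ ∧
      profileEnergy v φ ≠ ⊤ ∧ profileDefect φ ≠ ⊤ ∧ profileK φ ≠ ⊤ := by
  obtain ⟨-, R₀, hR₀⟩ := hv
  set R₁ : ℝ := max R₀ 1 with hR₁
  have hR₁pos : 0 < R₁ := lt_max_of_lt_right one_pos
  have hR₀R₁ : R₀ ≤ R₁ := le_max_left _ _
  set D : ℝ := (2 * R₁) ^ 2 - R₁ ^ 2 with hD
  have hDpos : 0 < D := by rw [hD]; nlinarith
  set φ : Space → ℝ := fun x => Real.smoothTransition ((‖x‖ ^ 2 - R₁ ^ 2) / D) with hφdef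
  -- smoothness
  have hφC : ContDiff ℝ 1 φ :=
    Real.smoothTransition.contDiff.comp (((contDiff_norm_sq ℝ).sub contDiff_const).div_const D)
  -- values
  have hφ0 : ∀ x : Space, ‖x‖ ≤ R₁ → φ x = 0 := fun x hx => by
    refine Real.smoothTransition.zero_of_nonpos (div_nonpos_of_nonpos_of_nonneg ?_ hDpos.le)
    have : ‖x‖ ^ 2 ≤ R₁ ^ 2 := pow_le_pow_left₀ (norm_nonneg _) hx 2
    linarith
  have hφ1 : ∀ x : Space, 2 * R₁ ≤ ‖x‖ → φ x = 1 := fun x hx => by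
    refine Real.smoothTransition.one_of_one_le ?_
    rw [le_div_iff₀ hDpos, one_mul, hD]
    have : (2 * R₁) ^ 2 ≤ ‖x‖ ^ 2 := pow_le_pow_left₀ (by positivity) hx 2
    linarith
  -- `ψ = 1 - φ` has compact support, so `∇φ = -∇ψ` is bounded and vanishes off the ball
  set ψ : Space → ℝ := fun x => 1 - φ x with hψdef
  have hψC : ContDiff ℝ 1 ψ := contDiff_const.sub hφC
  have hψsupp : HasCompactSupport ψ := by
    refine HasCompactSupport.intro (isCompact_closedBall (0 : Space) (2 * R₁)) fun x hx => ?_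
    rw [mem_closedBall_zero_iff, not_le] at hx
    simp only [hψdef, hφ1 x hx.le, sub_self]
  have hfd : ∀ x, fderiv ℝ φ x = -fderiv ℝ ψ x := fun x => by
    have h : fderiv ℝ (fun y => (1 : ℝ) - φ y) x = -fderiv ℝ φ x := fderiv_const_sub 1
    rw [show (fun y => (1 : ℝ) - φ y) = ψ from rfl] at h
    rw [h, neg_neg]
  have hek : ∀ k : Fin 3, ‖EuclideanSpace.single k (1 : ℝ)‖ = 1 := fun k => by simp
  obtain ⟨C, hC⟩ := (hψC.continuous_fderiv one_ne_zero).bounded_above_of_compact_support (hψsupp.fderiv ℝ)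
  have hC0 : 0 ≤ C := (norm_nonneg _).trans (hC 0)
  have hfdφ_le : ∀ x (w : Space), ‖fderiv ℝ φ x w‖ ≤ C * ‖w‖ := fun x w => by
    rw [hfd, _root_.neg_apply, norm_neg]
    exact (ContinuousLinearMap.le_opNorm _ _).trans (mul_le_mul_of_nonneg_right (hC x) (norm_nonneg _))
  have hfdφ_zero : ∀ x : Space, 2 * R₁ < ‖x‖ → fderiv ℝ φ x = 0 := fun x hx => by
    rw [hfd, neg_eq_zero, ← notMem_support]
    intro hmem
    have h1 : x ∈ tsupport ψ := support_fderiv_subset ℝ hmem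
    have h2 : tsupport ψ ⊆ closedBall (0 : Space) (2 * R₁) := by
      refine closure_minimal (fun y hy => ?_) isClosed_closedBall
      rw [mem_closedBall_zero_iff]
      by_contra hlt
      exact hy (by simp only [hψdef, hφ1 y (not_le.mp hlt).le, sub_self])
    have := h2 h1
    rw [mem_closedBall_zero_iff] at this
    exact absurd hx (not_lt.mpr this)
  -- the profile
  refine ⟨2 * R₁, by positivity, φ, ⟨hφC, fun x => Real.smoothTransition.nonneg _,
    fun x => Real.smoothTransition.le_one _, fun x => by simp only [hφdef, norm_neg], hφ1⟩, ?_, ?_, ?_⟩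
  · -- `E₁ = 2 ∫ (|∇φ|² + ½ v φ²) < ∞`: the potential term vanishes identically
    have hbound : ∀ x : Space, gradSq φ x + 2⁻¹ * v ‖x‖ * (‖φ x‖₊ : ℝ≥0∞) ^ 2 ≤
        3 * ENNReal.ofReal (C ^ 2) := fun x => by
      have hpot : 2⁻¹ * v ‖x‖ * (‖φ x‖₊ : ℝ≥0∞) ^ 2 = 0 := by
        rcases le_or_gt ‖x‖ R₁ with hx | hx
        · rw [hφ0 x hx, nnnorm_zero, ENNReal.coe_zero, zero_pow two_ne_zero, mul_zero]
        · rw [hR₀ ‖x‖ (hR₀R₁.trans_lt hx), mul_zero, zero_mul]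
      rw [hpot, add_zero, gradSq]
      calc ∑ k : Fin 3, (‖fderiv ℝ φ x (EuclideanSpace.single k (1 : ℝ))‖₊ : ℝ≥0∞) ^ 2
          ≤ ∑ _k : Fin 3, ENNReal.ofReal (C ^ 2) := Finset.sum_le_sum fun k _ => by
            rw [ennnorm_sq_eq_ofReal_sq]
            refine ENNReal.ofReal_le_ofReal ?_
            have h := hfdφ_le x (EuclideanSpace.single k (1 : ℝ))
            rw [hek k, mul_one, Real.norm_eq_abs] at h
            exact sq_le_sq.2 (by rwa [abs_of_nonneg hC0])
        _ = 3 * ENNReal.ofReal (C ^ 2) := by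
            rw [Finset.sum_const, Finset.card_univ, Fintype.card_fin, nsmul_eq_mul, Nat.cast_ofNat]
    have hzero : ∀ x : Space, 2 * R₁ < ‖x‖ →
        gradSq φ x + 2⁻¹ * v ‖x‖ * (‖φ x‖₊ : ℝ≥0∞) ^ 2 = 0 := fun x hx => by
      have hR₀x : R₀ < ‖x‖ := by
        have : R₁ < ‖x‖ := by linarith
        exact hR₀R₁.trans_lt this
      rw [hR₀ ‖x‖ hR₀x, mul_zero, zero_mul, add_zero, gradSq]
      refine Finset.sum_eq_zero fun k _ => ?_
      rw [hfdφ_zero x hx, _root_.zero_apply, nnnorm_zero, ENNReal.coe_zero,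
        zero_pow two_ne_zero]
    rw [profileEnergy, scatteringFunctional]
    exact ENNReal.mul_ne_top ENNReal.ofNat_ne_top
      (lintegral_ne_top_of_le_of_eq_zero (ENNReal.mul_ne_top ENNReal.ofNat_ne_top ENNReal.ofReal_ne_top)
        (2 * R₁) hbound hzero)
  · -- `I = ∫ (1 - φ²) ≤ |B_{2R₁}|`
    refine lintegral_ne_top_of_le_of_eq_zero ENNReal.one_ne_top (2 * R₁) (fun x => ?_) (fun x hx => ?_)
    · rw [← ENNReal.ofReal_one]
      exact ENNReal.ofReal_le_ofReal (by nlinarith [sq_nonneg (φ x)])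
    · rw [hφ1 x hx.le, one_pow, sub_self, ENNReal.ofReal_zero]
  · -- `K = ∫ φ |∇φ|`: `φ ≤ 1` and `|∇φ| ≤ √3 C`, zero off the ball
    have hgrad : ∀ x : Space, ‖gradVec φ x‖ ≤ Real.sqrt (3 * C ^ 2) := fun x => by
      rw [EuclideanSpace.norm_eq]
      refine Real.sqrt_le_sqrt ?_
      calc ∑ k : Fin 3, ‖gradVec φ x k‖ ^ 2 ≤ ∑ _k : Fin 3, C ^ 2 := Finset.sum_le_sum fun k _ => by
              rw [gradVec, PiLp.toLp_apply]
              have h := hfdφ_le x (EuclideanSpace.single k (1 : ℝ))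
              rw [hek k, mul_one] at h
              exact pow_le_pow_left₀ (norm_nonneg _) h 2
        _ = 3 * C ^ 2 := by
              rw [Finset.sum_const, Finset.card_univ, Fintype.card_fin, nsmul_eq_mul, Nat.cast_ofNat]
    refine lintegral_ne_top_of_le_of_eq_zero (C := ENNReal.ofReal (Real.sqrt (3 * C ^ 2)))
      ENNReal.ofReal_ne_top (2 * R₁) (fun x => ?_) (fun x hx => ?_)
    · refine ENNReal.ofReal_le_ofReal ?_
      calc φ x * ‖gradVec φ x‖ ≤ 1 * ‖gradVec φ x‖ :=
            mul_le_mul_of_nonneg_right (Real.smoothTransition.le_one _) (norm_nonneg _)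
        _ ≤ Real.sqrt (3 * C ^ 2) := by rw [one_mul]; exact hgrad x
    · have : gradVec φ x = 0 := by
        ext k
        rw [gradVec, PiLp.toLp_apply, hfdφ_zero x hx, _root_.zero_apply]
        rfl
      rw [this, norm_zero, mul_zero, ENNReal.ofReal_zero]

/-! ### At fixed particle number the free periodic energy is `O(L⁻³)` -/

/-- **`E^per(M, L) ≤ c/L²` on every large torus, for EVERY admissible `v` and every fixed `M`.** For
`M ≤ 1` the energy vanishes; for `M ≥ 2` the Jastrow bound [LSSY2005, Thm. 2.2, (2.19)–(2.31)]
(`LSSY2005_jastrowBound_holds`) with the core-vanishing profile of `exists_pairProfile_of_finiteRange`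
(finite `E₁, I, K`) gives `E^per(M, L) ≤ M²E₁/(2(L³ - (M-1)I)) + M³K²/(L³ - (M-1)I)² ≤ (M²E₁ + 4M³K²)/L³`
once `L ≥ max(2b + 1, 2(M-1)I + 1)`, which is `≤ c/L²` for `L ≥ (M²E₁ + 4M³K²)/c + 1`.
[cite: LSSY2005, Thm. 2.2, proof, (2.19)–(2.31)] -/
theorem exists_periodicGroundStateEnergy_le_div_sq {v : ℝ → ℝ≥0∞} (hv : IsRepulsiveFiniteRange v)
    (M : ℕ) {c : ℝ} (hc : 0 < c) :
    ∃ L₁ : ℝ, 0 < L₁ ∧ ∀ L : ℝ, L₁ ≤ L →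
      periodicGroundStateEnergy v M L ≤ ENNReal.ofReal (c / L ^ 2) := by
  rcases Nat.lt_or_ge M 2 with hM | hM
  · -- `M ≤ 1`: the energy vanishes (`E^per(0) ≤ E^per(1) = 0`)
    refine ⟨1, one_pos, fun L hL => ?_⟩
    have hLpos : 0 < L := one_pos.trans_le hL
    have h1 : periodicGroundStateEnergy v 1 L = 0 := periodicGroundStateEnergy_one hLpos v
    have h0 : periodicGroundStateEnergy v M L = 0 := by
      interval_cases M
      · exact le_antisymm ((periodicGroundStateEnergy_le_succ hv.1 0 L).trans h1.le) bot_le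
      · exact h1
    rw [h0]
    exact bot_le
  · obtain ⟨b, hb, φ, hφ, hE, hI, hK⟩ := exists_pairProfile_of_finiteRange hv
    set E : ℝ := (profileEnergy v φ).toReal with hEdef
    set I : ℝ := (profileDefect φ).toReal with hIdef
    set K : ℝ := (profileK φ).toReal with hKdef
    have hE0 : 0 ≤ E := ENNReal.toReal_nonneg
    have hI0 : 0 ≤ I := ENNReal.toReal_nonneg
    have hK0 : 0 ≤ K := ENNReal.toReal_nonneg
    have hM2 : (2 : ℝ) ≤ M := by exact_mod_cast hM
    set A : ℝ := (M : ℝ) ^ 2 * E + 4 * (M : ℝ) ^ 3 * K ^ 2 with hAdef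
    have hA0 : 0 ≤ A := by positivity
    refine ⟨max (2 * b + 1) (max (2 * ((M : ℝ) - 1) * I + 1) (A / c + 1)),
      lt_max_of_lt_left (by positivity), fun L hL => ?_⟩
    have hL2b : 2 * b + 1 ≤ L := (le_max_left _ _).trans hL
    have hLI : 2 * ((M : ℝ) - 1) * I + 1 ≤ L := ((le_max_left _ _).trans (le_max_right _ _)).trans hL
    have hLA : A / c + 1 ≤ L := ((le_max_right _ _).trans (le_max_right _ _)).trans hL
    have hL1 : 1 ≤ L := by linarith
    have hLpos : 0 < L := one_pos.trans_le hL1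
    have hL3 : L ≤ L ^ 3 := by
      calc L = L * 1 * 1 := by ring
        _ ≤ L * L * L := by gcongr
        _ = L ^ 3 := by ring
    have hMI2 : 2 * (((M : ℝ) - 1) * I) ≤ L ^ 3 := by linarith
    have hMI : ((M : ℝ) - 1) * I < L ^ 3 := by
      have : 0 ≤ ((M : ℝ) - 1) * I := mul_nonneg (by linarith) hI0
      linarith
    have hJ := LSSY2005_jastrowBound_holds v hv.1 M L b hM hLpos hb (by linarith) φ hφ E I K hE0 hI0 hK0
      (by rw [hEdef, ENNReal.ofReal_toReal hE]) (by rw [hIdef, ENNReal.ofReal_toReal hI])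
      (by rw [hKdef, ENNReal.ofReal_toReal hK]) hMI
    refine hJ.trans (ENNReal.ofReal_le_ofReal ?_)
    -- the real inequality
    set D : ℝ := L ^ 3 - ((M : ℝ) - 1) * I with hDdef
    have hD : L ^ 3 / 2 ≤ D := by rw [hDdef]; linarith
    have hL3pos : 0 < L ^ 3 := by positivity
    have hDpos : 0 < D := by linarith
    have hMM1 : (M : ℝ) * ((M : ℝ) - 1) ≤ (M : ℝ) ^ 2 := by nlinarith
    have h1 : (M : ℝ) * ((M : ℝ) - 1) / 2 * E / D ≤ (M : ℝ) ^ 2 * E / L ^ 3 := by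
      rw [div_le_div_iff₀ hDpos hL3pos]
      have hnum : (M : ℝ) * ((M : ℝ) - 1) / 2 * E ≤ (M : ℝ) ^ 2 / 2 * E :=
        mul_le_mul_of_nonneg_right (by linarith) hE0
      calc (M : ℝ) * ((M : ℝ) - 1) / 2 * E * L ^ 3 ≤ (M : ℝ) ^ 2 / 2 * E * L ^ 3 :=
            mul_le_mul_of_nonneg_right hnum hL3pos.le
        _ = (M : ℝ) ^ 2 * E * (L ^ 3 / 2) := by ring
        _ ≤ (M : ℝ) ^ 2 * E * D := mul_le_mul_of_nonneg_left hD (by positivity)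
    have h2 : (M : ℝ) * ((M : ℝ) - 1) * ((M : ℝ) - 2) * K ^ 2 / D ^ 2 ≤
        4 * (M : ℝ) ^ 3 * K ^ 2 / L ^ 3 := by
      rw [div_le_div_iff₀ (by positivity) hL3pos]
      have hnum : (M : ℝ) * ((M : ℝ) - 1) * ((M : ℝ) - 2) * K ^ 2 ≤ (M : ℝ) ^ 3 * K ^ 2 := by
        refine mul_le_mul_of_nonneg_right ?_ (sq_nonneg _)
        have h01 : 0 ≤ (M : ℝ) - 1 := by linarith
        have h02 : 0 ≤ (M : ℝ) - 2 := by linarith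
        calc (M : ℝ) * ((M : ℝ) - 1) * ((M : ℝ) - 2) ≤ (M : ℝ) * (M : ℝ) * (M : ℝ) := by
              gcongr <;> linarith
          _ = (M : ℝ) ^ 3 := by ring
      have hD2 : L ^ 3 * L ^ 3 / 4 ≤ D ^ 2 := by
        calc L ^ 3 * L ^ 3 / 4 = (L ^ 3 / 2) * (L ^ 3 / 2) := by ring
          _ ≤ D * D := mul_le_mul hD hD (by positivity) hDpos.le
          _ = D ^ 2 := (sq D).symm
      calc (M : ℝ) * ((M : ℝ) - 1) * ((M : ℝ) - 2) * K ^ 2 * L ^ 3 ≤ (M : ℝ) ^ 3 * K ^ 2 * L ^ 3 :=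
            mul_le_mul_of_nonneg_right hnum hL3pos.le
        _ ≤ (M : ℝ) ^ 3 * K ^ 2 * L ^ 3 * L ^ 3 := by
            have h13 : 1 ≤ L ^ 3 := hL1.trans hL3
            calc (M : ℝ) ^ 3 * K ^ 2 * L ^ 3 = (M : ℝ) ^ 3 * K ^ 2 * L ^ 3 * 1 := (mul_one _).symm
              _ ≤ (M : ℝ) ^ 3 * K ^ 2 * L ^ 3 * L ^ 3 :=
                  mul_le_mul_of_nonneg_left h13 (by positivity)
        _ = 4 * (M : ℝ) ^ 3 * K ^ 2 * (L ^ 3 * L ^ 3 / 4) := by ring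
        _ ≤ 4 * (M : ℝ) ^ 3 * K ^ 2 * D ^ 2 := mul_le_mul_of_nonneg_left hD2 (by positivity)
    have hAL : A / L ^ 3 ≤ c / L ^ 2 := by
      rw [div_le_div_iff₀ hL3pos (by positivity)]
      have hcL : A < c * L := by
        have := (div_lt_iff₀ hc).1 (show A / c < L by linarith)
        linarith [mul_comm L c]
      calc A * L ^ 2 ≤ c * L * L ^ 2 := mul_le_mul_of_nonneg_right hcL.le (by positivity)
        _ = c * L ^ 3 := by ring
    calc (M : ℝ) * ((M : ℝ) - 1) / 2 * E / D + (M : ℝ) * ((M : ℝ) - 1) * ((M : ℝ) - 2) * K ^ 2 / D ^ 2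
        ≤ (M : ℝ) ^ 2 * E / L ^ 3 + 4 * (M : ℝ) ^ 3 * K ^ 2 / L ^ 3 := add_le_add h1 h2
      _ = A / L ^ 3 := by rw [hAdef, add_div]
      _ ≤ c / L ^ 2 := hAL

/-! ### Registered sub-goal forms (closed statements) -/

/-- **Sub-goal `stub_impurityEnergy_le_succ` (registered on stmt-AtomisticToContinuum-12310): pinning one of
`N + 1` bosons lowers the energy**, `E_imp(N, L, 0) ≤ E^per(N + 1, L)` for every measurable `v ≥ 0`,
every `N`, `L` (closed form of `impurityPeriodicGroundStateEnergy_zero_le_succ`). [folklore] -/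
theorem stub_impurityEnergy_le_succ :
    ∀ (v : ℝ → ℝ≥0∞), Measurable v → ∀ (N : ℕ) (L : ℝ),
      impurityPeriodicGroundStateEnergy v N L 0 ≤ periodicGroundStateEnergy v (N + 1) L :=
  fun _ hv N L => impurityPeriodicGroundStateEnergy_zero_le_succ hv N L

/-- **Sub-goal `stub_periodicEnergy_fixedN_decay` (registered on stmt-AtomisticToContinuum-12310): at fixed
particle number the free periodic energy of EVERY admissible `v` is `o(L⁻²)`** — for every `c > 0`,
`E^per(M, L) ≤ c/L²` on all large tori (closed form of `exists_periodicGroundStateEnergy_le_div_sq`).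
[cite: LSSY2005, Thm. 2.2, proof, (2.19)–(2.31)] -/
theorem stub_periodicEnergy_fixedN_decay :
    ∀ (v : ℝ → ℝ≥0∞), IsRepulsiveFiniteRange v → ∀ (M : ℕ) (c : ℝ), 0 < c →
      ∃ L₁ : ℝ, 0 < L₁ ∧ ∀ L : ℝ, L₁ ≤ L →
        periodicGroundStateEnergy v M L ≤ ENNReal.ofReal (c / L ^ 2) :=
  fun _ hv M _ hc => exists_periodicGroundStateEnergy_le_div_sq hv M hc

end Summit.AtomisticToContinuum.BoseEinsteinCondensation.Cruxes.CloudMomentumAtom.Birth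

end
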